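import Literature.NumberTheory.EllipticCurves.IwasawaAlgebraLengthAwayComparisonProofs
import HarnessLib

/-!
# «splitslice» G5 — the EXCEPTIONAL DIVISOR of the signed logarithm and its glue (F-d follow-through, g37)

(v1.1: linter options `unusedVariables/unusedSectionVars` no longer disabled — critic V#26au n2.)
Companion to `SplitsliceG2.lean` / `SplitsliceG3.lean` / `QtameDoor5.lean` for the crux
`TwoVariableEulerSystemDivisibility` (stub F1 = `stub_ratEulerSystemSS` of `Lines/ratlift.lean` v5.4).
Desk check `FD-CHECK-g37.md` (same directory) found that the Euler-system reciprocity law used on the pencil lines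
`ℓ(μ₀) = {μ₀} × Γ̂_v̄` — the specialisation of the two-variable SIGNED logarithm
`L̃og^•_v = (h_K/w_K)·L_v^{ac}(K)·Log^•_v` of Castella–Çiperiani–Skinner–Sprung (arXiv:1804.10993 Prop 2.9, Thm 3.6) —
is `Λ`-adic with pseudo-null cokernel and carries only `ϖ^r·unit` constants on a line, EXCEPT at the one height-one
prime where its integrality is not asserted: the «exceptional» prime
`P := (γ_ac − 1)·Λ(Γ_K)` (loc. cit. p. 14: pull-back of the augmentation ideal of `Λ(Γ^ac)`; the cyclotomic line).
Every pencil line crosses `V(P)` in exactly one (deep) point, so a fibre bound there may carry a PARASITE `(T − u₁)^m`,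
and door 5 must treat `𝔓 = P` through such points. The remedy is the pair

* (G1″) door 5♭′: the patching engine run with the declared parasite, whose output is
  `∃ a m, (p^a · ϖ_P^m · G) ≤ ch X` (`ϖ_P = γ_ac − 1 = T₂` in the crux's `(cyc, ac)` frame), and
* (G5) `ℓ_P(X_Gr) = 0`, i.e. `X_Gr / P·X_Gr` is `Λ(Γ^cyc)`-torsion: by control this is the cotorsion of
  `Sel^{∅ v, 0 v̄}(E/K^cyc_∞)`; in the generalised-Heegner (analytic rank one) setting it follows at the BOTTOM LAYER from
  `dim H¹(𝒪_{K,S}, V_pE) = 2 = ⟨κ_Heeg, κ_Kato(E')⟩` (Gross–Zagier–Kolyvagin + Kato), `loc_v̄ κ_Heeg ∈ H¹_f ∖ 0`,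
  `loc_v̄ κ_Kato(E') ∉ H¹_f`; in general it is equivalent (Poitou–Tate, core rank 0, Kato's rank-2 `H¹_Iw(K^cyc)`) to the
  ANTISYMMETRIC mixed signed non-vanishing `D_{E,K} := L_p⁺(E)·L_p⁻(E^K) − L_p⁻(E)·L_p⁺(E^K) ≠ 0` in `Λ(Γ^cyc)`
  (companion of the symmetric products of loc. cit. Prop 3.5; `T² ∣ D_{E,K}` is forced by the functional equation when
  `L(E,1)L(E^K,1) ≠ 0`).

This file certifies, sorry-free, the GLUE «(G1″-output) ∧ (G5) ⟹ F1-shape conclusion» in the generality door 5 uses: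
over any domain a prime `ϖ` not dividing `c` can be cancelled from `c ∣ q·ϖ^m·y` (`dvd_of_dvd_mul_prime_pow`, no UFD
needed — this is the form used AFTER mapping `ch X` into `𝒪_{ℂ_p}⟦T₁,T₂⟧`, which is not factorial), and over a
Noetherian UFD the hypothesis `¬ ϖ ∣ c` for a generator `c` of `char M` is exactly `ℓ_ϖ(M) = 0`
(`span_le_charIdeal_of_parasite_of_lengthAt_eq_zero`, via the tree's `Module.exists_charIdeal_eq_span_pow_mul`);
the general form with `ℓ_ϖ(M)` arbitrary and `ϖ^{ℓ_ϖ(M)} ∣ G` is `span_le_charIdeal_of_parasite`.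
No statement about elliptic curves is proved here; BSD is not proved here.

References: [CCSS18] F. Castella, M. Çiperiani, C. Skinner, F. Sprung, arXiv:1804.10993, Prop 2.9, §3.3 (p. 14 L1–22),
Thm 3.6, Prop 3.5, Prop 5.2, Thm 5.10; [BL16] K. Büyükboduk, A. Lei, arXiv:1605.05310, Remark 3.13 (line-wise Greenberg
divisibilities «easily seen to patch» — the nearest prior art of door 5); Bourbaki AC VII §4.5; NSW (5.3.9)–(5.3.10).
-/

set_option autoImplicit false
set_option linter.dupNamespace false

noncomputable section

open scoped Classical
open Literature.NumberTheory.EllipticCurves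

namespace Summit.BirchSwinnertonDyer.BirchSwinnertonDyer.Cruxes.TwoVariableEulerSystemDivisibility.SplitsliceG5

/-! ## 1 · Cancelling a prime parasite (any domain) -/

section Domain

variable {R : Type*} [CommRing R] [IsDomain R]

/-- In a domain, a prime `ϖ` with `¬ ϖ ∣ c` can be cancelled: `c ∣ ϖ^m * y → c ∣ y`. (Induction on `m`; no
factoriality is used — this is the form needed in `𝒪_{ℂ_p}⟦T₁,T₂⟧`.) -/
theorem dvd_of_dvd_prime_pow_mul {ϖ c y : R} (hϖ : Prime ϖ) (hc : ¬ ϖ ∣ c) :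
    ∀ m : ℕ, c ∣ ϖ ^ m * y → c ∣ y
  | 0, h => by simpa using h
  | m + 1, h => by
    obtain ⟨e, he⟩ := h
    -- `ϖ ∣ c * e`, `ϖ ∤ c` ⟹ `ϖ ∣ e`
    have hϖe : ϖ ∣ e := by
      have : ϖ ∣ c * e := ⟨ϖ ^ m * y, by rw [← he]; ring⟩
      exact (hϖ.dvd_or_dvd this).resolve_left hc
    obtain ⟨e₁, rfl⟩ := hϖe
    refine dvd_of_dvd_prime_pow_mul hϖ hc m ⟨e₁, ?_⟩
    have h' : ϖ * (ϖ ^ m * y) = ϖ * (c * e₁) := by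
      calc ϖ * (ϖ ^ m * y) = ϖ ^ (m + 1) * y := by ring
        _ = c * (ϖ * e₁) := he
        _ = ϖ * (c * e₁) := by ring
    exact mul_left_cancel₀ hϖ.ne_zero h'

/-- Same, with an extra factor `q` (door 5's `p^a`): `c ∣ q * ϖ^m * y → c ∣ q * y`. -/
theorem dvd_of_dvd_mul_prime_pow {ϖ c q y : R} (hϖ : Prime ϖ) (hc : ¬ ϖ ∣ c) {m : ℕ}
    (h : c ∣ q * ϖ ^ m * y) : c ∣ q * y := by
  refine dvd_of_dvd_prime_pow_mul hϖ hc m ?_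
  simpa [mul_comm, mul_left_comm, mul_assoc] using h

/-- Ideal form: `(q·ϖ^m·y) ≤ (c)` and `ϖ ∤ c` give `(q·y) ≤ (c)`. -/
theorem span_le_span_of_parasite {ϖ c q y : R} (hϖ : Prime ϖ) (hc : ¬ ϖ ∣ c) {m : ℕ}
    (h : Ideal.span {q * ϖ ^ m * y} ≤ Ideal.span ({c} : Set R)) :
    Ideal.span {q * y} ≤ Ideal.span ({c} : Set R) := by
  rw [Ideal.span_singleton_le_span_singleton] at h ⊢
  exact dvd_of_dvd_mul_prime_pow hϖ hc h

omit [IsDomain R] in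
/-- Mapped form (the shape of F1's conclusion, which compares ideals inside a bigger ring `R'` through a ring map `φ`):
if `φ ϖ` is prime in `R'` and does not divide `φ c`, then `(q·(φ ϖ)^m·y) ≤ (c).map φ` gives `(q·y) ≤ (c).map φ`
(the source ring `R` need not be a domain — surfaced by the section-variable linter, v1.1). -/
theorem span_le_map_span_of_parasite {R' : Type*} [CommRing R'] [IsDomain R'] (φ : R →+* R') {ϖ c : R} {q y : R'}
    (hϖ : Prime (φ ϖ)) (hc : ¬ φ ϖ ∣ φ c) {m : ℕ}
    (h : Ideal.span {q * φ ϖ ^ m * y} ≤ (Ideal.span ({c} : Set R)).map φ) :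
    Ideal.span {q * y} ≤ (Ideal.span ({c} : Set R)).map φ := by
  rw [Ideal.map_span, Set.image_singleton] at h ⊢
  exact span_le_span_of_parasite hϖ hc h

end Domain

/-! ## 2 · Over a Noetherian UFD: `ϖ ∤ (generator of char M)` IS `ℓ_ϖ(M) = 0` -/

section UFD

variable {R : Type*} [CommRing R] [IsNoetherianRing R] [IsDomain R] [UniqueFactorizationMonoid R]
variable {M : Type*} [AddCommGroup M] [Module R M] [Module.Finite R M]

/-- **G5-glue, general form.** `M` finitely generated torsion over a Noetherian UFD, `ϖ` prime, `ℓ := ℓ_ϖ(M)`: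
if `ϖ^ℓ ∣ G` (G5: «`ℓ_P(X) ≤ ord_P(G)`») and `(q·ϖ^m·G) ≤ char M` (door 5♭′ output with parasite `ϖ^m`), then
`(q·G) ≤ char M`. -/
theorem span_le_charIdeal_of_parasite (hM : Module.IsTorsion R M) {ϖ : R} (hϖ : Prime ϖ) {q G : R} {m : ℕ}
    (hG : ϖ ^ (Module.lengthAt R M ⟨Ideal.span {ϖ}, (Ideal.span_singleton_prime hϖ.ne_zero).mpr hϖ⟩).toNat ∣ G)
    (h : Ideal.span {q * ϖ ^ m * G} ≤ Module.charIdeal R M) :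
    Ideal.span {q * G} ≤ Module.charIdeal R M := by
  obtain ⟨g, hg, hc⟩ := Module.exists_charIdeal_eq_span_pow_mul hM hϖ
  set ℓ : ℕ := (Module.lengthAt R M ⟨Ideal.span {ϖ}, (Ideal.span_singleton_prime hϖ.ne_zero).mpr hϖ⟩).toNat with hℓ
  obtain ⟨G', rfl⟩ := hG
  rw [hc, Ideal.span_singleton_le_span_singleton] at h ⊢
  -- `ϖ^ℓ g ∣ q ϖ^m ϖ^ℓ G'` ⟹ `g ∣ ϖ^m (q G')` ⟹ `g ∣ q G'` ⟹ `ϖ^ℓ g ∣ q ϖ^ℓ G'`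
  have h1 : g ∣ ϖ ^ m * (q * G') := by
    have hℓ0 : ϖ ^ ℓ ≠ 0 := pow_ne_zero _ hϖ.ne_zero
    have : ϖ ^ ℓ * g ∣ ϖ ^ ℓ * (ϖ ^ m * (q * G')) := by
      simpa [mul_comm, mul_left_comm, mul_assoc] using h
    exact (mul_dvd_mul_iff_left hℓ0).mp this
  have h2 : g ∣ q * G' := dvd_of_dvd_prime_pow_mul hϖ hg m h1
  calc ϖ ^ ℓ * g ∣ ϖ ^ ℓ * (q * G') := mul_dvd_mul_left _ h2
    _ = q * (ϖ ^ ℓ * G') := by ring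

/-- **G5-glue, the form used by «splitslice»** (`ℓ_P(X_Gr) = 0`): a parasite at a prime of length zero is harmless. -/
theorem span_le_charIdeal_of_parasite_of_lengthAt_eq_zero (hM : Module.IsTorsion R M) {ϖ : R} (hϖ : Prime ϖ)
    (hℓ : Module.lengthAt R M ⟨Ideal.span {ϖ}, (Ideal.span_singleton_prime hϖ.ne_zero).mpr hϖ⟩ = 0)
    {q G : R} {m : ℕ} (h : Ideal.span {q * ϖ ^ m * G} ≤ Module.charIdeal R M) :
    Ideal.span {q * G} ≤ Module.charIdeal R M :=
  span_le_charIdeal_of_parasite hM hϖ (by simp [hℓ]) h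

/-- The length-zero hypothesis in generator language: if `char M = (c)` then `ℓ_ϖ(M) = 0 ↔ ¬ ϖ ∣ c`
(`Module.lengthAt_eq_emultiplicity_of_charIdeal_eq_span`). This is what transports G5 into the big ring:
`¬ ϖ ∣ c` in `ℤ_p⟦T₁,T₂⟧` for `ϖ = T₂` descends/ascends coefficientwise along `ℤ_p⟦T₁,T₂⟧ → 𝒪_{ℂ_p}⟦T₁,T₂⟧`. -/
theorem lengthAt_eq_zero_iff_not_dvd (hM : Module.IsTorsion R M) {ϖ : R} (hϖ : Prime ϖ) {c : R}
    (hc : Module.charIdeal R M = Ideal.span {c}) :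
    Module.lengthAt R M ⟨Ideal.span {ϖ}, (Ideal.span_singleton_prime hϖ.ne_zero).mpr hϖ⟩ = 0 ↔ ¬ ϖ ∣ c := by
  rw [Module.lengthAt_eq_emultiplicity_of_charIdeal_eq_span hM hϖ hc, emultiplicity_eq_zero]

end UFD

/-! ## 3 · Two directions, two parasites (door 5♭′ bookkeeping)

With the proxy of `SplitsliceG2` the second pencil is the `τ`-image of the first, so its parasite sits on
`V(P^τ)`, and `P^τ = P` on the nose: `τ = c∘ι` FIXES `γ_ac` (both `c` and `ι` invert it) and inverts `γ_cyc`, so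
`τ(γ_ac − 1) = γ_ac − 1`. Hence ONE exceptional prime `P` and one instance of G5 serve both directions; the lemma below is the
two-parasite version of §1 anyway (parasites `ϖ₁^m₁`, `ϖ₂^m₂`, both of length zero), for an engine that prefers to
keep them separate. -/

section TwoParasites

variable {R : Type*} [CommRing R] [IsDomain R]

theorem dvd_of_dvd_mul_two_prime_pows {ϖ₁ ϖ₂ c q y : R} (h₁ : Prime ϖ₁) (h₂ : Prime ϖ₂)
    (hc₁ : ¬ ϖ₁ ∣ c) (hc₂ : ¬ ϖ₂ ∣ c) {m₁ m₂ : ℕ} (h : c ∣ q * ϖ₁ ^ m₁ * ϖ₂ ^ m₂ * y) : c ∣ q * y := by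
  have h' : c ∣ q * ϖ₁ ^ m₁ * (ϖ₂ ^ m₂ * y) := by simpa [mul_assoc] using h
  have h'' : c ∣ q * (ϖ₂ ^ m₂ * y) := dvd_of_dvd_mul_prime_pow h₁ hc₁ h'
  have h''' : c ∣ q * ϖ₂ ^ m₂ * y := by simpa [mul_assoc] using h''
  exact dvd_of_dvd_mul_prime_pow h₂ hc₂ h'''

end TwoParasites

end Summit.BirchSwinnertonDyer.BirchSwinnertonDyer.Cruxes.TwoVariableEulerSystemDivisibility.SplitsliceG5
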